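import Literature.Geometry.Lorentzian.CarterConeGoodZone
import Literature.Analysis.ODE.BarrierInteriorRate
import HarnessLib

/-!
# The interior reciprocal rate of Carter's barrier basis on the WHOLE barrier in BF-stable sectors,
# and the radial location of the two turning points relative to the κ-free good zone
(namespace `Literature.Geometry.Lorentzian.Kerr`.)

Carter's radial equation `u″ + φu = 0`, `φ = ω² − V∘ρ` (`V = Kerr.sepPotential M a ω m Λ`, `ρ` a tortoise
radius; DRSR arXiv:1402.7034 §5.2.3) in the threshold cone with a Breitenlohner–Freedman margin
`(1 + θ₁)(2r₊ω)² ≤ Λ′ := Λ − 2amω`, `0 < θ₁ ≤ 1`, `18432 M²σ² ≤ θ₁⁴Λ′` (`σ = ω − mω₊`).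
`CarterConeGoodZone.carter_goodZone_depth_and_rates` gives, from the κ-free good zone
`r ∈ [r₊(1 + θ₁/8), r₊(1 + θ₁/4)]` (coefficient floor `k² = θ₁³Λ′/(3584 r₊²)`, tortoise length `≥ 2r₊/5`),
the exponential depth and the two END rates of every monotone two-end real basis `g, d` of the barrier
`[b₁, b₂]`, plus the interior rate `g d ≤ (4/k)w₀` ON the zone. Here the interior rate is extended to the
whole barrier by the convexity transport of `Literature.Analysis.ODE.barrierBasis_interior_rate` (the
reciprocal rates grow at most linearly in the tortoise variable away from the zone):

* `rho_ends_of_forbidden_eq_Icc` — if the forbidden set is `[b₁, b₂]` then `ρ b₁ ≤ r₊(1 + θ₁/8)` and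
  `r₊(1 + θ₁/4) ≤ ρ b₂` (the good zone lies inside the barrier);
* `carter_cone_depth_and_rates` — under the hypotheses of `carter_goodZone_depth_and_rates`
  (`x_a ≤ b₁`, `ρ x_a = r₊ + σ²M³/(416Λ)`, `ρ b₂ ≤ R_f`, `R_f ≥ 7M`, `89600 ≤ θ₁³Λ′`):
  `(k/4)e^{2r₊k/5} ≤ w₀`, `d(b₁) ≤ (L + 2/k)w₀`, `g(b₂) ≤ (200M/θ₁ + (7/5)R_f + 2/k)w₀`, and for EVERY
  `x ∈ [b₁, b₂]`: `g(x)d(x) ≤ (L + 200M/θ₁ + (7/5)R_f + 4/k)w₀`, `L = (25/κ)log(2496Λ/(σ²M²))`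
  (`t₁ − b₁ ≤ L` by `IsTortoiseRadius.tameZone_length_le`, `b₂ − t₂ ≤ 200M/θ₁ + (7/5)R_f` by
  `IsTortoiseRadius.sub_le_div_sub_rPlus` and `IsTortoiseRadius.sub_le_mul_sub`).

These are ALL the basis inputs (`D`, `R_α`, `R_β`, `R_m`) of `Literature.Analysis.ODE.kernel_le_of_deep_barrier`
for the superradiant BF-stable cone kernel bound; polynomial in `Λ/κ`. All proved.

## References
* M. Dafermos, I. Rodnianski, Y. Shlapentokh-Rothman, arXiv:1402.7034 = Ann. of Math. 183 (2016),
  §§2.1.2, 5.2.3, 6.2 (key `DafermosRodnianskiShlapentokhrothman2014`).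
* P. Hartman, *Ordinary Differential Equations* (SIAM Classics 38, 2002), Ch. XI (key `Hartman2002`).
  The assembly is folklore.
-/

noncomputable section

open Set Literature.Analysis.ODE

namespace Literature.Geometry.Lorentzian

namespace Kerr

section InteriorRate

variable {M a ω Λ : ℝ} {m : ℤ} {ρ : ℝ → ℝ}

/-- **The turning points relative to the good zone.** Along a tortoise radius of a sub-extremal exterior,
with `0 < θ₁ ≤ 1`, the margin and `18432 M²σ² ≤ θ₁⁴Λ′`: if the forbidden set `{s | ω² − V(ρ s) ≤ 0}`
equals `[b₁, b₂]`, then `ρ b₁ ≤ r₊(1 + θ₁/8)` and `r₊(1 + θ₁/4) ≤ ρ b₂`. [folklore] -/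
theorem rho_ends_of_forbidden_eq_Icc (hρ : IsTortoiseRadius M a ρ) (hMa : IsSubextremal M a)
    {θ₁ : ℝ} (hθ₁ : 0 < θ₁) (hθ₁1 : θ₁ ≤ 1)
    (hmargin : (1 + θ₁) * (2 * rPlus M a * ω) ^ 2 ≤ Λ - 2 * a * m * ω)
    (hσ : 18432 * M ^ 2 * (ω - m * horizonAngularVelocity M a) ^ 2 ≤ θ₁ ^ 4 * (Λ - 2 * a * m * ω))
    {b₁ b₂ : ℝ} (hF : {s | ω ^ 2 - sepPotential M a ω m Λ (ρ s) ≤ 0} = Icc b₁ b₂) :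
    ρ b₁ ≤ rPlus M a * (1 + θ₁ / 8) ∧ rPlus M a * (1 + θ₁ / 4) ≤ ρ b₂ := by
  have hM : 0 < M := hMa.pos
  have hrp0 : 0 < rPlus M a := rPlus_pos hM a
  obtain ⟨t₁, t₂, hlt, ht₁, ht₂, hlen, hzone⟩ := exists_good_zone hρ hMa hθ₁ hθ₁1 hmargin hσ
  -- the floor is positive (the zone has positive tortoise length, so `θ₁³Λ′ > 0`… use the zone bound at `t₁`
  -- together with the far-collar positivity instead: `k² ≥ 0` suffices for membership)
  have hΛ'0 : 0 ≤ Λ - 2 * a * m * ω := le_trans (by positivity) hmargin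
  have hin : ∀ s ∈ Icc t₁ t₂, s ∈ Icc b₁ b₂ := by
    intro s hs
    have h1 : 0 ≤ θ₁ ^ 3 * (Λ - 2 * a * m * ω) / (3584 * rPlus M a ^ 2) := by positivity
    have h2 := hzone s hs
    have : s ∈ {s | ω ^ 2 - sepPotential M a ω m Λ (ρ s) ≤ 0} := by
      show ω ^ 2 - sepPotential M a ω m Λ (ρ s) ≤ 0
      linarith
    rwa [hF] at this
  have hb₁t₁ : b₁ ≤ t₁ := (hin t₁ (left_mem_Icc.2 hlt.le)).1
  have ht₂b₂ : t₂ ≤ b₂ := (hin t₂ (right_mem_Icc.2 hlt.le)).2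
  constructor
  · rw [← ht₁]; exact (hρ.strictMono hMa).monotone hb₁t₁
  · rw [← ht₂]; exact (hρ.strictMono hMa).monotone ht₂b₂

set_option maxHeartbeats 400000 in
-- long hypothesis list (the barrier basis); the proof is plumbing around the good zone
-- adapted from Literature/Geometry/Lorentzian/CarterConeGoodZone.lean (`carter_goodZone_depth_and_rates`)
/-- **Depth, end rates and the interior rate on the whole barrier.** Along a tortoise radius of a
sub-extremal exterior (`Λ ≥ 1`, `σ = ω − mω₊ ≠ 0`), with `0 < θ₁ ≤ 1`, the margin, `18432 M²σ² ≤ θ₁⁴Λ′`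
and `89600 ≤ θ₁³Λ′`: if the forbidden set equals `[b₁, b₂]` with `x_a ≤ b₁` (`ρ x_a = r₊ + σ²M³/(416Λ)`)
and `ρ b₂ ≤ R_f`, `R_f ≥ 7M`, then every monotone two-end real basis `g, d` of `y″ = (V(ρ s) − ω²) y` on
`[b₁, b₂]` (`w₀ = g′(b₂)`) satisfies, with `k = √(θ₁³Λ′/(3584 r₊²))`, `L = (25/κ)log(2496Λ/(σ²M²))`:
`(k/4)e^{2r₊k/5} ≤ w₀`, `d(b₁) ≤ (L + 2/k)w₀`, `g(b₂) ≤ (200M/θ₁ + (7/5)R_f + 2/k)w₀`, and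
`g(x)d(x) ≤ (L + 200M/θ₁ + (7/5)R_f + 4/k)w₀` for every `x ∈ [b₁, b₂]`. [folklore] -/
theorem carter_cone_depth_and_rates (hρ : IsTortoiseRadius M a ρ) (hMa : IsSubextremal M a)
    (hΛ : 1 ≤ Λ) (hσ0 : ω - m * horizonAngularVelocity M a ≠ 0)
    {θ₁ : ℝ} (hθ₁ : 0 < θ₁) (hθ₁1 : θ₁ ≤ 1)
    (hmargin : (1 + θ₁) * (2 * rPlus M a * ω) ^ 2 ≤ Λ - 2 * a * m * ω)
    (hσ : 18432 * M ^ 2 * (ω - m * horizonAngularVelocity M a) ^ 2 ≤ θ₁ ^ 4 * (Λ - 2 * a * m * ω))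
    (hΛ' : 89600 ≤ θ₁ ^ 3 * (Λ - 2 * a * m * ω))
    {b₁ b₂ xa Rf : ℝ} (hF : {s | ω ^ 2 - sepPotential M a ω m Λ (ρ s) ≤ 0} = Icc b₁ b₂)
    (hxa : ρ xa = rPlus M a + (ω - m * horizonAngularVelocity M a) ^ 2 * M ^ 3 / (416 * Λ))
    (hxab : xa ≤ b₁) (hRf : 7 * M ≤ Rf) (hb₂R : ρ b₂ ≤ Rf)
    {g g' d d' : ℝ → ℝ} {w₀ : ℝ}
    (hg : ∀ x ∈ Icc b₁ b₂, HasDerivAt g (g' x) x ∧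
      HasDerivAt g' (-(ω ^ 2 - sepPotential M a ω m Λ (ρ x)) * g x) x)
    (hd : ∀ x ∈ Icc b₁ b₂, HasDerivAt d (d' x) x ∧
      HasDerivAt d' (-(ω ^ 2 - sepPotential M a ω m Λ (ρ x)) * d x) x)
    (hgα : g b₁ = 1) (hg'α : g' b₁ = 0) (hg'β : g' b₂ = w₀)
    (hsign : ∀ x ∈ Icc b₁ b₂, 1 ≤ g x ∧ 0 ≤ g' x ∧ 1 ≤ d x ∧ d' x ≤ 0)
    (hW : ∀ x ∈ Icc b₁ b₂, g x * d' x - g' x * d x = -w₀) :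
    Real.sqrt (θ₁ ^ 3 * (Λ - 2 * a * m * ω) / (3584 * rPlus M a ^ 2)) / 4 *
        Real.exp (2 * rPlus M a *
          Real.sqrt (θ₁ ^ 3 * (Λ - 2 * a * m * ω) / (3584 * rPlus M a ^ 2)) / 5) ≤ w₀ ∧
    d b₁ ≤ (25 / surfaceGravity M a *
        Real.log (2496 * Λ / ((ω - m * horizonAngularVelocity M a) ^ 2 * M ^ 2)) +
        2 / Real.sqrt (θ₁ ^ 3 * (Λ - 2 * a * m * ω) / (3584 * rPlus M a ^ 2))) * w₀ ∧
    g b₂ ≤ (200 * M / θ₁ + 7 / 5 * Rf +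
        2 / Real.sqrt (θ₁ ^ 3 * (Λ - 2 * a * m * ω) / (3584 * rPlus M a ^ 2))) * w₀ ∧
    ∀ x ∈ Icc b₁ b₂, g x * d x ≤
      (25 / surfaceGravity M a *
          Real.log (2496 * Λ / ((ω - m * horizonAngularVelocity M a) ^ 2 * M ^ 2)) +
        200 * M / θ₁ + 7 / 5 * Rf +
        4 / Real.sqrt (θ₁ ^ 3 * (Λ - 2 * a * m * ω) / (3584 * rPlus M a ^ 2))) * w₀ := by
  obtain ⟨hdepth, hRα, hRβ, -⟩ := carter_goodZone_depth_and_rates hρ hMa hΛ hσ0 hθ₁ hθ₁1 hmargin hσ hΛ'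
    hF hxa hxab hRf hb₂R hg hd hgα hg'α hg'β hsign hW
  refine ⟨hdepth, hRα, hRβ, fun x hx ↦ ?_⟩
  have hM : 0 < M := hMa.pos
  set rp := rPlus M a with hrp
  set Λ' := Λ - 2 * a * m * ω with hΛ'def
  set σ := ω - m * horizonAngularVelocity M a with hσdef
  set k := Real.sqrt (θ₁ ^ 3 * Λ' / (3584 * rp ^ 2)) with hk
  set q : ℝ → ℝ := fun s ↦ -(ω ^ 2 - sepPotential M a ω m Λ (ρ s)) with hq
  have hrpM : M ≤ rp := M_le_rPlus M a
  have hrp0 : 0 < rp := rPlus_pos hM a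
  have hΛ'0 : 0 < Λ' := by
    by_contra hle
    push Not at hle
    have : θ₁ ^ 3 * Λ' ≤ 0 := mul_nonpos_of_nonneg_of_nonpos (by positivity) hle
    linarith
  have hk2 : k ^ 2 = θ₁ ^ 3 * Λ' / (3584 * rp ^ 2) := Real.sq_sqrt (by positivity)
  have hk0 : 0 < k := Real.sqrt_pos.2 (by positivity)
  -- the good zone, inside the barrier
  obtain ⟨t₁, t₂, hlt, ht₁, ht₂, hlen, hzone⟩ := exists_good_zone hρ hMa hθ₁ hθ₁1 hmargin hσ
  have hin : ∀ s ∈ Icc t₁ t₂, s ∈ Icc b₁ b₂ := by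
    intro s hs
    have h1 : 0 < θ₁ ^ 3 * Λ' / (3584 * rp ^ 2) := by positivity
    have h2 := hzone s hs
    have : s ∈ {s | ω ^ 2 - sepPotential M a ω m Λ (ρ s) ≤ 0} := by
      show ω ^ 2 - sepPotential M a ω m Λ (ρ s) ≤ 0
      linarith
    rwa [hF] at this
  have hb₁t₁ : b₁ ≤ t₁ := (hin t₁ (left_mem_Icc.2 hlt.le)).1
  have ht₂b₂ : t₂ ≤ b₂ := (hin t₂ (right_mem_Icc.2 hlt.le)).2
  have hq0 : ∀ x ∈ Icc b₁ b₂, 0 ≤ q x := by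
    intro x hx
    have : x ∈ {s | ω ^ 2 - sepPotential M a ω m Λ (ρ s) ≤ 0} := by rw [hF]; exact hx
    have h : ω ^ 2 - sepPotential M a ω m Λ (ρ x) ≤ 0 := this
    show 0 ≤ -(ω ^ 2 - sepPotential M a ω m Λ (ρ x))
    linarith
  have hqk : ∀ s ∈ Icc t₁ t₂, k ^ 2 ≤ q s := by
    intro s hs
    rw [hk2]
    have := hzone s hs
    show θ₁ ^ 3 * Λ' / (3584 * rp ^ 2) ≤ -(ω ^ 2 - sepPotential M a ω m Λ (ρ s))
    linarith
  have hkℓ : 2 ≤ k * (t₂ - t₁) := by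
    have h1 : 5 ≤ k * rp := by
      have h2 : (25 : ℝ) ≤ (k * rp) ^ 2 := by
        rw [mul_pow, hk2]
        have e : θ₁ ^ 3 * Λ' / (3584 * rp ^ 2) * rp ^ 2 = θ₁ ^ 3 * Λ' / 3584 := by field_simp
        rw [e, le_div_iff₀ (by norm_num)]
        linarith
      have h3 : 0 ≤ k * rp := by positivity
      by_contra hcon
      push Not at hcon
      have h4 : (k * rp) ^ 2 < 5 ^ 2 := pow_lt_pow_left₀ hcon h3 two_ne_zero
      linarith
    calc (2 : ℝ) = 5 * (2 / 5) := by norm_num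
      _ ≤ (k * rp) * (2 / 5) := by gcongr
      _ = k * (2 * rp / 5) := by ring
      _ ≤ k * (t₂ - t₁) := mul_le_mul_of_nonneg_left hlen hk0.le
  -- the interior rate in terms of the tortoise lengths of the two tails
  have key := barrierBasis_interior_rate hg hd hq0 hgα hg'α hg'β hsign hW hb₁t₁ hlt ht₂b₂ hk0 hqk hkℓ hx
  have hw₀ : 0 ≤ w₀ := by
    rw [← hg'β]; exact (hsign b₂ (right_mem_Icc.2 (hb₁t₁.trans (hlt.le.trans ht₂b₂)))).2.1
  -- `t₁ − b₁ ≤ t₁ − xa ≤ L`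
  have hL : t₁ - b₁ ≤ 25 / surfaceGravity M a * Real.log (2496 * Λ / (σ ^ 2 * M ^ 2)) := by
    have hxat₁ : xa ≤ t₁ := hxab.trans hb₁t₁
    have ht₁7 : ρ t₁ ≤ 7 * M := by
      rw [ht₁]
      have h2M : rp ≤ 2 * M := rPlus_le_two_mul_self hM.le a
      have h5 : rp * (1 + θ₁ / 8) ≤ rp * (9 / 8) := mul_le_mul_of_nonneg_left (by linarith) hrp0.le
      linarith
    have h := hρ.tameZone_length_le hMa hσ0 hΛ hxa.ge hxat₁ ht₁7
    linarith
  -- `b₂ − t₂ ≤ 200M/θ₁ + (7/5)R_f`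
  have ht₂r : ρ t₂ - rp = θ₁ * rp / 4 := by rw [ht₂]; ring
  have hnear : ∀ y, t₂ ≤ y → ρ y ≤ 7 * M → y - t₂ ≤ 200 * M / θ₁ := by
    intro y hy hy7
    have h1 := hρ.sub_le_div_sub_rPlus hMa hy hy7
    rw [ht₂r] at h1
    have h2 : 50 * M ^ 2 / (θ₁ * rp / 4) ≤ 200 * M / θ₁ := by
      rw [div_le_div_iff₀ (by positivity) hθ₁]
      calc 50 * M ^ 2 * θ₁ = (50 * M * θ₁) * M := by ring
        _ ≤ (50 * M * θ₁) * rp := mul_le_mul_of_nonneg_left hrpM (by positivity)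
        _ = 200 * M * (θ₁ * rp / 4) := by ring
    exact h1.trans h2
  have hfar : b₂ - t₂ ≤ 200 * M / θ₁ + 7 / 5 * Rf := by
    have hRf0 : 0 ≤ Rf := by linarith
    have h75 : 0 ≤ 7 / 5 * Rf := by positivity
    have h2M : rp ≤ 2 * M := rPlus_le_two_mul_self hM.le a
    rcases le_or_gt (ρ b₂) (7 * M) with h7 | h7
    · linarith [hnear b₂ ht₂b₂ h7]
    · have h7p : rp < 7 * M := by linarith
      obtain ⟨x₇, hx₇⟩ := hρ.exists_apply_eq h7p
      have ht₂x₇ : t₂ ≤ x₇ := by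
        rw [← hρ.le_iff_le hMa, hx₇, ht₂]
        have h5 : rp * (1 + θ₁ / 4) ≤ rp * (5 / 4) :=
          mul_le_mul_of_nonneg_left (by linarith) hrp0.le
        linarith
      have hx₇b₂ : x₇ ≤ b₂ := by
        rw [← hρ.le_iff_le hMa, hx₇]; exact h7.le
      have h1 := hnear x₇ ht₂x₇ hx₇.le
      have h2 : b₂ - x₇ ≤ 7 / 5 * (ρ b₂ - ρ x₇) := hρ.sub_le_mul_sub hMa hx₇b₂ hx₇.ge
      have h3 : ρ b₂ - ρ x₇ ≤ Rf := by rw [hx₇]; linarith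
      have h4 : 7 / 5 * (ρ b₂ - ρ x₇) ≤ 7 / 5 * Rf := by linarith
      linarith
  refine key.trans (mul_le_mul_of_nonneg_right ?_ hw₀)
  linarith

end InteriorRate

end Kerr

end Literature.Geometry.Lorentzian

end
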